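import Summits.QuantumFields.BalabanUV.T4Continuum.Support.NE7EtaBackgroundFlatOrbit
import HarnessLib

/-!
# NE7EtaBackgroundFlatStratum — route #1 of the NE7 crux (node U5): the (A)-bill of NODE O's background coordinate is
# INHABITED on the whole FLAT STRATUM of the datum class (flat `N`-periodic data = pure gauges `1^{w}` of QUASI-periodic
# unitary `w`; torons = flat data with non-trivial commuting holonomies INCLUDED), with discrepancy direction `Z = 0`

Cell `pub-balaban`, rung (B)+1 sub-cell t4, lineage `b2b-balaban-t4-ne7-p1`, generation 58 (CRUX PROVER NE7 #1, ruling e34b3e0c (2));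
crux skeleton `t4/skeletons/NE7-CRUX-R1.md` v1.7.17 §2 (stub S7 = NODE O's background coordinate) ∕ §3quindecies; part 1 of 2 (part 2 =
`Support/NE7EtaBackgroundFlatStratumZero`: the zero-action ∕ zero-curvature descriptions, strictness, the dischargers in docked form).
HONEST FRAMING (page 1): FIXED FINITE T⁴, rung (B)+1; NE7 is the cell's OWN estimate, NOT PRINTED in [Balaban1984PropagatorsI]–
[Balaban1989LargeFieldII] and NOT PROVED here; continuum YM on T⁴ ⇐ BetaPertH ∧ nine spine estimates (0/9 proved); BetaPertH ⇐ (D1) ∧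
(D4) ∧ CAP+tail; G-an2-4 gates asym, D1 and NE2/3/4; NOT infinite volume, NOT mass gap, NOT Clay.

WHAT ([folklore]; 0 def; 0 sorry).  Generation 57 (`Support/NE7EtaBackgroundFlatOrbit`, p319377) discharged the four (A)-hypotheses
of `NE7Route1EndDocked.goodClause_summable_of_route1_docked` (p317648) — `hdom`, NE3's (H∃) `hmin`, NE3's covariant root amendment 4
`h`, `v₁ ∈ dom` — on the BASE POINT `dom` = the `U(n)`-valued `N`-periodic gauge ORBIT of the flat configuration.  On the torus that
orbit is NOT the whole zero-curvature locus: a flat `N`-periodic configuration is `1^{w}` with `w` unitary but only QUASI-periodic,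
`w(x + N e_i) = w(x)·h_i` with (commuting) holonomy constants `h_i ∈ U(n)` — the torons; for `N = 1` the orbit is the single point `1`
while every constant unitary configuration is flat (part 2).  This file discharges the same four hypotheses on the whole
**FLAT STRATUM** `{v N-periodic | ∃ w unitary, v = 1^{w}}` (= `{v ∈ sfClass d L N ε 0 | A^{(0)}(v) = 0}` = `{v unitary N-periodic |
every plaquette variable is 1}`, part 2), for every `L, N ≥ 1`, `ε, b, c ≥ 0`, `C, Λ₁, Λ₂′ ≥ 0`, again with `Z = 0`:
 * §1 QUASI-PERIODIC GAUGES: `1^{g}` is `P`-periodic iff `g(x + P e_i) = g(x)·(g(0)⁻¹ g(P e_i))`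
   (`apply_add_period_eq_of_isPeriodicCfg` ∕ `isPeriodicCfg_gaugeAct_flatCfg_of_apply_add_period`); the blow-up `z ↦ w(⌊z∕L^k⌋)` of
   a quasi-periodic `w` gives an `(N·L^k)`-periodic pure gauge (`isPeriodicCfg_blowup`), in `sfClass` (`gaugeAct_flatCfg_mem_sfClass`);
 * §2 `gaugeAct_mem_flatStratum` (= `hdom`), `flatCfg_mem_flatStratum` (= `hv₁`), `flatOrbit_subset_flatStratum` (the base point lies
   in the stratum);
 * §3 **`hmin_flatStratum`** (= (H∃) `hmin`): the blown-up pure gauge minimises every run of a flat datum in `sfClass ε` (action `0`)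
   and is `RegularSup` (`regularSup_gaugeAct_flatCfg_of_isPeriodicCfg` — periodicity of the CONFIGURATION suffices);
 * §4 **`exists_gauge_of_isMinimiser_flatStratum`**: every run-`k` minimiser of a flat datum `1^{w}` is `1^{g}` with `g` unitary and,
   after absorbing ONE constant, `g∘(L^k•) = w` EXACTLY — so `g` carries the SAME holonomy constants as `w`
   (`apply_add_period_of_uLev_eq`); **`minimiser_unique_mod_gauge_flatStratum`** (X-A2's located (β) on the stratum: two minimisers
   differ by a PERIODIC unitary gauge);
 * §5 **`covRoot_flatStratum`** (= the root binder `h`, ANY `d`): for minimisers `U_A = 1^{g_A}` (level `k`) and `U_B = 1^{g_B}` (level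
   `k+1`) so normalised, `u = (g_B∘(L•))·g_A⁻¹` IS `(N·L^k)`-periodic — the holonomy constants CANCEL, which is exactly where the
   torus stratum differs from the base point — and `U_A^{u} = rescale L (bavg L U_B)·e^{0}` EXACTLY: `Z = 0`, weighted energy `0`,
   covariant Lipschitz conjuncts `‖0‖`.
So the (A)-bill of the docked theorem is JOINTLY SATISFIABLE on the largest `dom` on which a ZERO discrepancy direction is possible
(the run-`k` minimiser gauge-equivalent, by a periodic gauge, to the averaged run-`(k+1)` minimiser), torons included; what it does NOT
say: anything at a datum with curvature — NE3's root and (H∃) remain HYPOTHESES there (X-A4, unseated).  NOT NE3, NOT NE7; nothing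
printed is asserted; no `def`, no `sorry`, axioms ⊆ {propext, Classical.choice, Quot.sound}.  HONEST: route 1 stays KERNEL-COMPLETE AT
FORM LEVEL ∕ DEPENDENT; NE7 NOT proved; spine 0∕9.
-/

set_option autoImplicit false

open scoped BigOperators Matrix Matrix.Norms.L2Operator
open NormedSpace Finset

namespace Summit.QuantumFields.BalabanUV.T4Continuum.NE7EtaBackgroundFlatStratum

open Literature.MathematicalPhysics.QuantumFieldTheory.Balaban1983to89
open B7Prop1Explicit B7Prop2Explicit MatrixLog UnitaryModel
open T4AveragingDeficitWall hiding Site Plane Plaq Bond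
open T4AveragingDeficitWallBoundary (IsPeriodicCfg periodBox)
open B7AvgGaugeCovariance (uLev uLev_apply)
open AveragingDeficitPeriodicCounting (IsPeriodicDir isPeriodicDir_zero)
open AveragingDeficitNearIdentity (Ad_zero)
open AveragingDeficitKDatum (isUnitaryCfg_gaugeAct)
open BlockAverageCurrent (smallField_gaugeAct)
open MinimalActionLevels (levelAction levelAction_nonneg)
open MinimalActionSandwich (IsMinimiser admissible)
open MinimalActionRate (sfClass Regular)
open MinimalActionRefine (RegularSup)
open MinimalActionWitness (flatCfg avgIter_flatCfg flatCfg_mem_sfClass levelAction_flatCfg isPeriodicCfg_flatCfg)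
open NE3EnergyShapes (residualScale residualScale_nonneg IsUnitarySite IsPeriodicSite)
open NE3EnergyWeightedShapes (energyNormW energyNormW_zero)
open NE3ResidualSliceRep (isPeriodicCfg_gaugeAct)
open NE3EnergyRateFlatClass (hol_plaqWord_eq_one_of_levelAction_eq_zero exists_unitary_gauge_eq_gaugeAct_flatCfg
  avgIter_gaugeAct_flatCfg apply_eq_apply_zero_of_gaugeAct_flatCfg_eq apply_eq_apply_zero_of_forall_add_e gaugeAct_inv_gaugeAct')
open NE3ClassSixFlatWitness (hol_gaugeAct_flatCfg_plaqWord fhol_gaugeAct_flatCfg)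
open NE7EtaMinimiserGaugeCovariance (levelAction_gaugeAct)
open NE7EtaBackgroundFlatOrbit (uLev_blowup isUnitarySite_blowup)

noncomputable section

variable {d : ℕ} {n : Type*} [Fintype n] [DecidableEq n]

/-! ## §1 Quasi-periodic gauges: the holonomy constants of a periodic pure gauge; blow-ups -/

/-- **HOLONOMY CONSTANTS OF A PERIODIC PURE GAUGE**: if `1^{g}` is `P`-periodic then `g(x + P e_i) = g(x)·h_i` with the
CONSTANT `h_i = g(0)⁻¹ g(P e_i)` (the quotient `g(x)⁻¹ g(x + P e_i)` is invariant under unit steps, hence constant; for a periodic `g`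
all `h_i = 1` — `NE3EnergyRateFlatClass.isPeriodicSite_of_gaugeAct_flatCfg`). [folklore] -/
theorem apply_add_period_eq_of_isPeriodicCfg {g : Site d → (Matrix n n ℂ)ˣ} {P : ℤ}
    (hper : IsPeriodicCfg (gaugeAct g (flatCfg : Site d → Fin d → (Matrix n n ℂ)ˣ)) P) (x : Site d) (i : Fin d) :
    g (x + P • e i) = g x * ((g 0)⁻¹ * g (P • e i)) := by
  have hstep : ∀ (w : Site d) (μ : Fin d),
      (fun w => (g w)⁻¹ * g (w + P • e i)) (w + e μ) = (fun w => (g w)⁻¹ * g (w + P • e i)) w := by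
    intro w μ
    have h1 := hper w i μ
    simp only [gaugeAct, flatCfg, mul_one] at h1
    show (g (w + e μ))⁻¹ * g (w + e μ + P • e i) = (g w)⁻¹ * g (w + P • e i)
    rw [add_right_comm w (e μ) (P • e i)]
    calc (g (w + e μ))⁻¹ * g (w + P • e i + e μ)
        = (g w)⁻¹ * (g w * (g (w + e μ))⁻¹) * g (w + P • e i + e μ) := by group
      _ = (g w)⁻¹ * (g (w + P • e i) * (g (w + P • e i + e μ))⁻¹) * g (w + P • e i + e μ) := by rw [h1]
      _ = (g w)⁻¹ * g (w + P • e i) := by group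
  have hc := apply_eq_apply_zero_of_forall_add_e (f := fun w => (g w)⁻¹ * g (w + P • e i)) hstep x
  simp only [zero_add] at hc
  rw [← hc, mul_inv_cancel_left]

/-- Conversely, a gauge with holonomy constants (`g(x + P e_i) = g(x)·h_i`) gives a `P`-periodic pure gauge `1^{g}`. [folklore] -/
theorem isPeriodicCfg_gaugeAct_flatCfg_of_apply_add_period {g : Site d → (Matrix n n ℂ)ˣ} {P : ℤ} (h : Fin d → (Matrix n n ℂ)ˣ)
    (hg : ∀ (x : Site d) (i : Fin d), g (x + P • e i) = g x * h i) :
    IsPeriodicCfg (gaugeAct g (flatCfg : Site d → Fin d → (Matrix n n ℂ)ˣ)) P := by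
  intro x i μ
  simp only [gaugeAct, flatCfg, mul_one]
  rw [add_right_comm, hg x i, hg (x + e μ) i]
  group

/-- **THE BLOW-UP OF A QUASI-PERIODIC GAUGE IS A PERIODIC PURE GAUGE**: if `1^{w}` is `N`-periodic then the pure gauge of the
blow-up `z ↦ w(⌊z∕L^k⌋)` is `(N·L^k)`-periodic (`L ≥ 1`; its holonomy constants are `w`'s). [folklore] -/
theorem isPeriodicCfg_blowup {L : ℕ} (hL : 1 ≤ L) {N : ℕ} {w : Site d → (Matrix n n ℂ)ˣ}
    (hw : IsPeriodicCfg (gaugeAct w (flatCfg : Site d → Fin d → (Matrix n n ℂ)ˣ)) (N : ℤ)) (k : ℕ) :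
    IsPeriodicCfg (gaugeAct (fun z : Site d => w (fun i => z i / ((L : ℤ) ^ k))) (flatCfg : Site d → Fin d → (Matrix n n ℂ)ˣ))
      ((N * L ^ k : ℕ) : ℤ) := by
  have hLk : ((L : ℤ) ^ k) ≠ 0 := pow_ne_zero _ (by exact_mod_cast (by omega : L ≠ 0))
  refine isPeriodicCfg_gaugeAct_flatCfg_of_apply_add_period (fun i => (w 0)⁻¹ * w ((N : ℤ) • e i)) fun x j => ?_
  have hx : (fun i => (x + ((N * L ^ k : ℕ) : ℤ) • e j) i / ((L : ℤ) ^ k))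
      = (fun i => x i / ((L : ℤ) ^ k)) + (N : ℤ) • e j := by
    funext i
    simp only [Pi.add_apply, Pi.smul_apply, smul_eq_mul]
    have hc : ((N * L ^ k : ℕ) : ℤ) * e j i = ((N : ℤ) * e j i) * ((L : ℤ) ^ k) := by push_cast; ring
    rw [hc, Int.add_mul_ediv_right _ _ hLk]
  show w (fun i => (x + ((N * L ^ k : ℕ) : ℤ) • e j) i / ((L : ℤ) ^ k))
      = w (fun i => x i / ((L : ℤ) ^ k)) * ((w 0)⁻¹ * w ((N : ℤ) • e j))
  rw [hx, apply_add_period_eq_of_isPeriodicCfg hw]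

/-- A pure gauge `1^{g}` with `g` unitary is a `U(n)`-valued configuration. [folklore] -/
theorem isUnitaryCfg_gaugeAct_flatCfg {g : Site d → (Matrix n n ℂ)ˣ} (hg : IsUnitarySite g) :
    IsUnitaryCfg (gaugeAct g (flatCfg : Site d → Fin d → (Matrix n n ℂ)ˣ)) :=
  isUnitaryCfg_gaugeAct hg fun _ _ => by unfold flatCfg; exact (unitaryUnits (Matrix n n ℂ)).one_mem

/-- A pure gauge `1^{g}` with `g` unitary lies in `sfClass d L N ε k` as soon as it is `(N·L^k)`-periodic (`ε ≥ 0`; plaquettes `1`).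
[folklore] -/
theorem gaugeAct_flatCfg_mem_sfClass [Nonempty n] {L N : ℕ} {ε : ℝ} (hε : 0 ≤ ε) {k : ℕ} {g : Site d → (Matrix n n ℂ)ˣ}
    (hg : IsUnitarySite g)
    (hper : IsPeriodicCfg (gaugeAct g (flatCfg : Site d → Fin d → (Matrix n n ℂ)ˣ)) ((N * L ^ k : ℕ) : ℤ)) :
    gaugeAct g (flatCfg : Site d → Fin d → (Matrix n n ℂ)ˣ) ∈ sfClass d L N ε k :=
  ⟨isUnitaryCfg_gaugeAct_flatCfg hg, hper, smallField_gaugeAct hg (flatCfg_mem_sfClass (d := d) (n := n) L N hε k).2.2⟩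

/-- Absorbing a constant on the right does not change the pure gauge: `1^{g·c} = 1^{g}`. [folklore] -/
theorem gaugeAct_mul_const_flatCfg (g : Site d → (Matrix n n ℂ)ˣ) (c : (Matrix n n ℂ)ˣ) :
    gaugeAct (fun x => g x * c) (flatCfg : Site d → Fin d → (Matrix n n ℂ)ˣ) = gaugeAct g flatCfg := by
  funext x μ
  simp only [gaugeAct, flatCfg, mul_one, mul_inv_rev]
  group

/-! ## §2 The flat stratum (pure-gauge description): closure (`hdom`), the reference datum (`hv₁`), the base point inside it -/

/-- **`hdom` ON THE FLAT STRATUM**: `{v N-periodic | ∃ w unitary, v = 1^{w}}` is closed under unitary `N`-periodic gauge transformations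
(`(1^{w})^{w′} = 1^{w′w}`, periodicity by `isPeriodicCfg_gaugeAct`). [folklore] -/
theorem gaugeAct_mem_flatStratum (N : ℕ) :
    ∀ v ∈ {v : Site d → Fin d → (Matrix n n ℂ)ˣ | IsPeriodicCfg v (N : ℤ) ∧ ∃ w : Site d → (Matrix n n ℂ)ˣ,
        IsUnitarySite w ∧ v = gaugeAct w flatCfg},
      ∀ w' : Site d → (Matrix n n ℂ)ˣ, IsUnitarySite w' → IsPeriodicSite w' (N : ℤ) →
        gaugeAct w' v ∈ {v : Site d → Fin d → (Matrix n n ℂ)ˣ | IsPeriodicCfg v (N : ℤ) ∧ ∃ w : Site d → (Matrix n n ℂ)ˣ,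
          IsUnitarySite w ∧ v = gaugeAct w flatCfg} := by
  rintro v ⟨hvP, w, hwu, rfl⟩ w' hw'u hw'p
  refine ⟨isPeriodicCfg_gaugeAct hw'p hvP, w' * w, fun x => (unitaryUnits (Matrix n n ℂ)).mul_mem (hw'u x) (hwu x), ?_⟩
  funext x μ
  simp only [gaugeAct, Pi.mul_apply, mul_inv_rev, mul_assoc]

/-- **`hv₁` ON THE FLAT STRATUM**: the flat configuration lies in the stratum (`w = 1`). [folklore] -/
theorem flatCfg_mem_flatStratum (N : ℕ) :
    (flatCfg : Site d → Fin d → (Matrix n n ℂ)ˣ) ∈ {v : Site d → Fin d → (Matrix n n ℂ)ˣ | IsPeriodicCfg v (N : ℤ) ∧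
        ∃ w : Site d → (Matrix n n ℂ)ˣ, IsUnitarySite w ∧ v = gaugeAct w flatCfg} :=
  ⟨isPeriodicCfg_flatCfg _, fun _ => 1, fun _ => (unitaryUnits (Matrix n n ℂ)).one_mem, by
    funext x μ; simp only [gaugeAct, one_mul, inv_one, mul_one]⟩

/-- **THE BASE POINT LIES IN THE STRATUM**: generation 57's flat orbit `{1^{w} : w unitary, N-periodic}` is a subset of the flat
stratum (a periodic gauge gives a periodic pure gauge). [folklore] -/
theorem flatOrbit_subset_flatStratum (N : ℕ) :
    {v : Site d → Fin d → (Matrix n n ℂ)ˣ | ∃ w : Site d → (Matrix n n ℂ)ˣ,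
        IsUnitarySite w ∧ IsPeriodicSite w (N : ℤ) ∧ v = gaugeAct w flatCfg}
      ⊆ {v : Site d → Fin d → (Matrix n n ℂ)ˣ | IsPeriodicCfg v (N : ℤ) ∧ ∃ w : Site d → (Matrix n n ℂ)ˣ,
        IsUnitarySite w ∧ v = gaugeAct w flatCfg} := by
  rintro v ⟨w, hwu, hwp, rfl⟩
  exact ⟨isPeriodicCfg_gaugeAct hwp (isPeriodicCfg_flatCfg _), w, hwu, rfl⟩

/-! ## §3 (H∃) on the flat stratum: the blown-up pure gauge is a `RegularSup` minimiser -/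

/-- The blown-up pure gauge `1^{z ↦ w(⌊z∕L^k⌋)}` is admissible for run `k` of the flat datum `1^{w}` in `sfClass ε` (`L ≥ 1`, `ε ≥ 0`,
`w` unitary, `1^{w}` `N`-periodic): it lies in the class (§1) and its `k`-fold average is `1^{w}` ((45) and `uLev_blowup`). [folklore] -/
theorem blowup_mem_admissible_flatStratum [Nonempty n] {L N : ℕ} (hL : 1 ≤ L) {ε : ℝ} (hε : 0 ≤ ε) {w : Site d → (Matrix n n ℂ)ˣ}
    (hwu : IsUnitarySite w) (hwP : IsPeriodicCfg (gaugeAct w (flatCfg : Site d → Fin d → (Matrix n n ℂ)ˣ)) (N : ℤ)) (k : ℕ) :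
    gaugeAct (fun z : Site d => w (fun i => z i / ((L : ℤ) ^ k))) flatCfg
      ∈ admissible (sfClass d L N ε) L k (gaugeAct w flatCfg) :=
  ⟨gaugeAct_flatCfg_mem_sfClass hε (isUnitarySite_blowup hwu L k) (isPeriodicCfg_blowup hL hwP k),
    by rw [avgIter_gaugeAct_flatCfg, uLev_blowup hL]⟩

/-- **A PERIODIC PURE GAUGE OF `1` IS `RegularSup`** — the variant of `NE3ClassSixFlatWitness.regularSup_gaugeAct_flatCfg` that asks
periodicity of the CONFIGURATION `1^{g}` only (so quasi-periodic `g`, i.e. torons, are allowed): unitary, periodic, plaquettes `1`,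
flux `0`, flux gradient `0`; all `b, c ≥ 0`. [folklore] -/
theorem regularSup_gaugeAct_flatCfg_of_isPeriodicCfg {L N k : ℕ} {g : Site d → (Matrix n n ℂ)ˣ} (hg : IsUnitarySite g)
    (hper : IsPeriodicCfg (gaugeAct g (flatCfg : Site d → Fin d → (Matrix n n ℂ)ˣ)) ((N * L ^ k : ℕ) : ℤ))
    {b c : ℝ} (hb : 0 ≤ b) (hc : 0 ≤ c) :
    RegularSup d L N b c k (gaugeAct g (flatCfg : Site d → Fin d → (Matrix n n ℂ)ˣ)) where
  unitary := isUnitaryCfg_gaugeAct_flatCfg hg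
  periodic := hper
  small := fun x κ κ' _ => by
    rw [hol_gaugeAct_flatCfg_plaqWord, Units.val_one, sub_self, norm_zero]
    positivity
  grad := fun x κ π => by
    have h0 : covGrad (gaugeAct g (flatCfg : Site d → Fin d → (Matrix n n ℂ)ˣ)) (flux (gaugeAct g flatCfg)) x κ π = 0 := by
      unfold covGrad flux
      rw [fhol_gaugeAct_flatCfg, fhol_gaugeAct_flatCfg, Units.val_one, mlog_one]
      simp [Ad]
    rw [h0, norm_zero]
    positivity

/-- **(H∃) `hmin` ON THE FLAT STRATUM** — literally the binder `hmin` of `NE7Route1EndDocked.goodClause_summable_of_route1_docked` with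
`dom :=` the flat stratum: for `L ≥ 1`, `ε, b, c ≥ 0`, every flat `N`-periodic datum `1^{w}` (`w` unitary, quasi-periodic) and every run
`k`, the blown-up pure gauge minimises the level-`k` action over `admissible (sfClass ε) L k (1^{w})` (its action is `0`, every `U(n)`
action is `≥ 0`) and is `RegularSup d L N b c k`. [folklore] -/
theorem hmin_flatStratum [Nonempty n] {L N : ℕ} (hL : 1 ≤ L) {ε b c : ℝ} (hε : 0 ≤ ε) (hb : 0 ≤ b) (hc : 0 ≤ c) :
    ∀ V ∈ {v : Site d → Fin d → (Matrix n n ℂ)ˣ | IsPeriodicCfg v (N : ℤ) ∧ ∃ w : Site d → (Matrix n n ℂ)ˣ,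
        IsUnitarySite w ∧ v = gaugeAct w flatCfg},
      ∀ k : ℕ, ∃ U, IsMinimiser d (sfClass d L N ε) L N k V U ∧ RegularSup d L N b c k U := by
  rintro V ⟨hVP, w, hwu, rfl⟩ k
  refine ⟨gaugeAct (fun z : Site d => w (fun i => z i / ((L : ℤ) ^ k))) flatCfg,
    ⟨blowup_mem_admissible_flatStratum hL hε hwu hVP k, fun U' hU' => ?_⟩,
    regularSup_gaugeAct_flatCfg_of_isPeriodicCfg (isUnitarySite_blowup hwu L k) (isPeriodicCfg_blowup hL hVP k) hb hc⟩
  rw [levelAction_gaugeAct, levelAction_flatCfg]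
  exact levelAction_nonneg L N k hL hU'.1.1

/-! ## §4 Every minimiser of a flat datum is a pure gauge with the datum's holonomy constants -/

/-- **MINIMISERS OF FLAT DATA ARE PURE GAUGES, NORMALISED ON THE CORNERS**: for `L, N ≥ 1`, `ε ≥ 0`, `w` unitary with `1^{w}`
`N`-periodic, every run-`k` minimiser `U` of the datum `1^{w}` in `sfClass ε` is `1^{g}` with `g` unitary and `g∘(L^k•) = w` EXACTLY.
Zero action (the blown-up pure gauge competes with action `0`) ⇒ zero curvature (`hol_plaqWord_eq_one_of_levelAction_eq_zero`) ⇒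
`U = 1^{g₀}` (`exists_unitary_gauge_eq_gaugeAct_flatCfg`); the constraint `1^{g₀∘(L^k•)} = 1^{w}` makes `w⁻¹·(g₀∘(L^k•))` a constant `c`
(`apply_eq_apply_zero_of_gaugeAct_flatCfg_eq`), and `g := g₀·c⁻¹` has the same pure gauge (`gaugeAct_mul_const_flatCfg`). [folklore] -/
theorem exists_gauge_of_isMinimiser_flatStratum [Nonempty n] {L N : ℕ} (hL : 1 ≤ L) (hN : 1 ≤ N) {ε : ℝ} (hε : 0 ≤ ε)
    {w : Site d → (Matrix n n ℂ)ˣ} (hwu : IsUnitarySite w)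
    (hwP : IsPeriodicCfg (gaugeAct w (flatCfg : Site d → Fin d → (Matrix n n ℂ)ˣ)) (N : ℤ)) {k : ℕ}
    {U : Site d → Fin d → (Matrix n n ℂ)ˣ} (hU : IsMinimiser d (sfClass d L N ε) L N k (gaugeAct w flatCfg) U) :
    ∃ g : Site d → (Matrix n n ℂ)ˣ, IsUnitarySite g ∧ U = gaugeAct g flatCfg ∧ uLev L g k = w := by
  obtain ⟨hUmem, havg⟩ := hU.mem
  obtain ⟨hunit, hperU, _⟩ := hUmem
  -- zero action: the blown-up pure gauge competes with action `0`
  have hA0 : levelAction d L N k U = 0 := by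
    refine le_antisymm ?_ (levelAction_nonneg L N k hL hunit)
    have h := hU.le _ (blowup_mem_admissible_flatStratum hL hε hwu hwP k)
    rwa [levelAction_gaugeAct, levelAction_flatCfg] at h
  -- zero curvature, pure gauge
  have hflat := hol_plaqWord_eq_one_of_levelAction_eq_zero hL hN hunit hperU hA0
  obtain ⟨g₀, hg₀u, hUg₀⟩ := exists_unitary_gauge_eq_gaugeAct_flatCfg hunit hflat
  -- the constraint: `1^{g₀ ∘ (L^k •)} = 1^{w}`, so `w⁻¹ · (g₀ ∘ (L^k •))` is a constant
  have hcon : gaugeAct (uLev L g₀ k) (flatCfg : Site d → Fin d → (Matrix n n ℂ)ˣ) = gaugeAct w flatCfg := by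
    rw [← avgIter_gaugeAct_flatCfg, ← hUg₀, havg]
  have hcon' : gaugeAct (fun z => (w z)⁻¹ * uLev L g₀ k z) (flatCfg : Site d → Fin d → (Matrix n n ℂ)ˣ) = flatCfg := by
    have h1 : gaugeAct (fun z => (w z)⁻¹) (gaugeAct (uLev L g₀ k) (flatCfg : Site d → Fin d → (Matrix n n ℂ)ˣ))
        = flatCfg := by
      rw [hcon, gaugeAct_inv_gaugeAct']
    have h2 : gaugeAct (fun z => (w z)⁻¹ * uLev L g₀ k z) (flatCfg : Site d → Fin d → (Matrix n n ℂ)ˣ)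
        = gaugeAct (fun z => (w z)⁻¹) (gaugeAct (uLev L g₀ k) flatCfg) := by
      funext x μ
      simp only [gaugeAct, mul_inv_rev, mul_assoc]
    rw [h2, h1]
  have hconst : ∀ z : Site d, (w z)⁻¹ * uLev L g₀ k z = (w 0)⁻¹ * uLev L g₀ k 0 :=
    apply_eq_apply_zero_of_gaugeAct_flatCfg_eq (G := (Matrix n n ℂ)ˣ) hcon'
  -- absorb the constant
  refine ⟨fun x => g₀ x * ((w 0)⁻¹ * uLev L g₀ k 0)⁻¹,
    fun x => (unitaryUnits (Matrix n n ℂ)).mul_mem (hg₀u x) ((unitaryUnits (Matrix n n ℂ)).inv_mem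
      ((unitaryUnits (Matrix n n ℂ)).mul_mem ((unitaryUnits (Matrix n n ℂ)).inv_mem (hwu 0)) (hg₀u _))),
    by rw [gaugeAct_mul_const_flatCfg, hUg₀], ?_⟩
  funext z
  have hz := hconst z
  simp only [uLev_apply] at hz ⊢
  -- hz : (w z)⁻¹ * g₀ (L^k • z) = (w 0)⁻¹ * g₀ (L^k • 0)
  rw [← hz]
  group

/-- **THE HOLONOMY CONSTANTS OF A NORMALISED MINIMISER GAUGE ARE THE DATUM'S**: if `1^{g}` is `(N·L^k)`-periodic and `g∘(L^k•) = w`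
then `g(x + N L^k e_i) = g(x)·(w(0)⁻¹ w(N e_i))`. [folklore] -/
theorem apply_add_period_of_uLev_eq {L N k : ℕ} {g w : Site d → (Matrix n n ℂ)ˣ}
    (hper : IsPeriodicCfg (gaugeAct g (flatCfg : Site d → Fin d → (Matrix n n ℂ)ˣ)) ((N * L ^ k : ℕ) : ℤ))
    (huLev : uLev L g k = w) (x : Site d) (i : Fin d) :
    g (x + ((N * L ^ k : ℕ) : ℤ) • e i) = g x * ((w 0)⁻¹ * w ((N : ℤ) • e i)) := by
  rw [apply_add_period_eq_of_isPeriodicCfg hper x i, ← huLev]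
  simp only [uLev_apply, smul_zero, smul_smul]
  congr 3
  push_cast
  ring

/-- **UNIQUENESS MODULO PERIODIC GAUGE ON THE FLAT STRATUM** (the stratum case of [Balaban1985Variational] Thm 1's uniqueness clause,
generation 56's located (β) for X-A2): any two run-`k` minimisers in `sfClass ε` of a flat `N`-periodic datum `1^{w}` (`w` unitary;
`L, N ≥ 1`, `ε ≥ 0`) differ by a unitary `(N·L^k)`-PERIODIC gauge transformation — both are `1^{g}`, `1^{g′}` normalised on the corners
(§4), so `g′·g⁻¹` has trivial holonomy constants. [folklore] -/
theorem minimiser_unique_mod_gauge_flatStratum [Nonempty n] {L N : ℕ} (hL : 1 ≤ L) (hN : 1 ≤ N) {ε : ℝ} (hε : 0 ≤ ε)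
    {w : Site d → (Matrix n n ℂ)ˣ} (hwu : IsUnitarySite w)
    (hwP : IsPeriodicCfg (gaugeAct w (flatCfg : Site d → Fin d → (Matrix n n ℂ)ˣ)) (N : ℤ)) {k : ℕ}
    {U U' : Site d → Fin d → (Matrix n n ℂ)ˣ} (hU : IsMinimiser d (sfClass d L N ε) L N k (gaugeAct w flatCfg) U)
    (hU' : IsMinimiser d (sfClass d L N ε) L N k (gaugeAct w flatCfg) U') :
    ∃ u : Site d → (Matrix n n ℂ)ˣ, IsUnitarySite u ∧ IsPeriodicSite u ((N * L ^ k : ℕ) : ℤ) ∧ U' = gaugeAct u U := by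
  have hperU : IsPeriodicCfg U ((N * L ^ k : ℕ) : ℤ) := hU.mem.1.2.1
  have hperU' : IsPeriodicCfg U' ((N * L ^ k : ℕ) : ℤ) := hU'.mem.1.2.1
  obtain ⟨g, hgu, rfl, hgw⟩ := exists_gauge_of_isMinimiser_flatStratum hL hN hε hwu hwP hU
  obtain ⟨g', hg'u, rfl, hg'w⟩ := exists_gauge_of_isMinimiser_flatStratum hL hN hε hwu hwP hU'
  refine ⟨fun x => g' x * (g x)⁻¹,
    fun x => (unitaryUnits (Matrix n n ℂ)).mul_mem (hg'u x) ((unitaryUnits (Matrix n n ℂ)).inv_mem (hgu x)),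
    fun x i => ?_, ?_⟩
  · show g' (x + ((N * L ^ k : ℕ) : ℤ) • e i) * (g (x + ((N * L ^ k : ℕ) : ℤ) • e i))⁻¹ = g' x * (g x)⁻¹
    rw [apply_add_period_of_uLev_eq hperU hgw, apply_add_period_of_uLev_eq hperU' hg'w, mul_inv_rev]
    group
  · funext x μ
    simp only [gaugeAct, flatCfg, mul_one, mul_inv_rev, inv_inv]
    group

/-! ## §5 NE3's covariant root amendment 4 on the flat stratum, direction `Z = 0` -/

/-- **NE3's COVARIANT ROOT (amendment 4) ON THE FLAT STRATUM** — literally the binder `h` of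
`NE7Route1EndDocked.goodClause_summable_of_route1_docked` with `dom :=` the flat stratum (there `d = 4`), for `L, N ≥ 1`, `ε ≥ 0`, all
`b, g` and every `C, Λ₁, Λ₂′ ≥ 0`: for minimisers `U_A = 1^{g_A}` (level `k`, `g_A∘(L^k•) = w`) and `U_B = 1^{g_B}` (level `k+1`,
`g_B∘(L^{k+1}•) = w`) of a flat datum `1^{w}` (§4), `rescale L (bavg L U_B) = 1^{g_B∘(L•)}` ((45)), and the unitary gauge
`u = (g_B∘(L•))·g_A⁻¹` IS `(N·L^k)`-periodic — `g_A` and `g_B∘(L•)` carry the SAME holonomy constants `w(0)⁻¹w(N e_i)`, which cancel —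
and gives `U_A^{u} = W·e^{0}` EXACTLY: direction `Z = 0` (skew, periodic), weighted energy `0 ≤ C·residualScale_k`, both covariant
Lipschitz conjuncts `‖0‖ ≤ Λ₁ξ², ‖0‖ ≤ Λ₂′ξ³`.  The flat stratum of the background coordinate, torons included; NOTHING at a datum with
curvature. [folklore] -/
theorem covRoot_flatStratum [Nonempty n] {L N : ℕ} (hL : 1 ≤ L) (hN : 1 ≤ N) {ε : ℝ} (hε : 0 ≤ ε) (b g : ℝ)
    {C Λ₁ Λ₂' : ℝ} (hC : 0 ≤ C) (hΛ₁ : 0 ≤ Λ₁) (hΛ₂' : 0 ≤ Λ₂') :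
    ∀ k : ℕ, 1 ≤ k → ∀ V ∈ {v : Site d → Fin d → (Matrix n n ℂ)ˣ | IsPeriodicCfg v (N : ℤ) ∧ ∃ w : Site d → (Matrix n n ℂ)ˣ,
        IsUnitarySite w ∧ v = gaugeAct w flatCfg},
      ∀ UA UB : (Site d → Fin d → (Matrix n n ℂ)ˣ),
      IsMinimiser d (sfClass d L N ε) L N k V UA → IsMinimiser d (sfClass d L N ε) L N (k + 1) V UB →
        Regular d L N b g (k + 1) UB →
        ∃ (u : Site d → (Matrix n n ℂ)ˣ) (Z : Site d → Fin d → Matrix n n ℂ),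
          IsUnitarySite u ∧ IsPeriodicSite u ((N * L ^ k : ℕ) : ℤ) ∧
          IsSkewDir Z ∧ IsPeriodicDir Z ((N * L ^ k : ℕ) : ℤ) ∧
          gaugeAct u UA = vary (rescale L (bavg L UB)) Z 1 ∧
          energyNormW L k (rescale L (bavg L UB)) Z (periodBox (N * L ^ k)) ≤ C * residualScale d L N b g k ∧
          (∀ (κ : Fin d) (x : Site d) (μ : Fin d),
            ‖Ad (rescale L (bavg L UB) (x + e κ) μ) (Z (x + e μ) κ) - Z x κ‖ ≤ Λ₁ * (((L : ℝ)⁻¹) ^ k) ^ 2) ∧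
          (∀ (κ μ : Fin d) (y : Site d),
            ‖Ad (rescale L (bavg L UB) (y + e κ) μ)
                (Ad (rescale L (bavg L UB) (y + e κ + e μ) μ) (Z (y + (2 : ℕ) • e μ) κ) - Z (y + e μ) κ)
              - (Ad (rescale L (bavg L UB) (y + e κ) μ) (Z (y + e μ) κ) - Z y κ)‖ ≤ Λ₂' * (((L : ℝ)⁻¹) ^ k) ^ 3) := by
  rintro k - V ⟨hVP, w, hwu, rfl⟩ UA UB hA hB -
  have hperA : IsPeriodicCfg UA ((N * L ^ k : ℕ) : ℤ) := hA.mem.1.2.1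
  have hperB : IsPeriodicCfg UB ((N * L ^ (k + 1) : ℕ) : ℤ) := hB.mem.1.2.1
  obtain ⟨gA, hgAu, hUA, hgAw⟩ := exists_gauge_of_isMinimiser_flatStratum hL hN hε hwu hVP hA
  obtain ⟨gB, hgBu, hUB, hgBw⟩ := exists_gauge_of_isMinimiser_flatStratum hL hN hε hwu hVP hB
  -- the averaged run-B minimiser read on run A's lattice is the pure gauge `1^{g_B ∘ (L•)}`
  have hW : rescale L (bavg L UB) = gaugeAct (uLev L gB 1) flatCfg := by
    have h := avgIter_gaugeAct_flatCfg L gB 1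
    rw [← hUB] at h
    exact h
  refine ⟨fun x => uLev L gB 1 x * (gA x)⁻¹, fun (_ : Site d) (_ : Fin d) => (0 : Matrix n n ℂ),
    fun x => (unitaryUnits (Matrix n n ℂ)).mul_mem (hgBu _) ((unitaryUnits (Matrix n n ℂ)).inv_mem (hgAu x)),
    fun x i => ?_, fun _ _ => (skewAdjoint (Matrix n n ℂ)).zero_mem, isPeriodicDir_zero _, ?_, ?_, ?_, ?_⟩
  · -- periodicity of the gauge `u`: the holonomy constants of `g_A` and `g_B ∘ (L•)` are both `w(0)⁻¹ w(N e_i)` and cancel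
    have hB' : gB ((L : ℤ) • x + ((N * L ^ (k + 1) : ℕ) : ℤ) • e i) = gB ((L : ℤ) • x) * ((w 0)⁻¹ * w ((N : ℤ) • e i)) :=
      apply_add_period_of_uLev_eq (hUB ▸ hperB) hgBw _ i
    have hcast : (L : ℤ) * ((N * L ^ k : ℕ) : ℤ) = ((N * L ^ (k + 1) : ℕ) : ℤ) := by push_cast; ring
    simp only [uLev_apply, pow_one]
    rw [smul_add, smul_smul, hcast, hB', apply_add_period_of_uLev_eq (hUA ▸ hperA) hgAw x i, mul_inv_rev]
    group
  · -- `U_A^u = W · e^0`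
    rw [vary_zero_dir, hW, hUA]
    funext x μ
    simp only [gaugeAct, flatCfg, mul_one]
    group
  · rw [energyNormW_zero]
    exact mul_nonneg hC (residualScale_nonneg d L N b g k)
  · intro κ x μ
    simp only [Ad_zero, sub_zero, norm_zero]
    positivity
  · intro κ μ y
    simp only [Ad_zero, sub_zero, norm_zero]
    positivity

end

end Summit.QuantumFields.BalabanUV.T4Continuum.NE7EtaBackgroundFlatStratum
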